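import Literature.AlgebraicGeometry.Limits.FiniteTypeModel
import Literature.AlgebraicGeometry.Limits.ClosedSubschemes
import Literature.AlgebraicGeometry.Limits.SubalgebraDiagram
import HarnessLib

/-!
# Separated schemes of finite type over a Noetherian ring are defined over a finitely generated subring

Topic: `Literature/AlgebraicGeometry/Limits` (EGA IV₃ Thm. 8.8.2 (ii); The Stacks Project, Tags
01ZA and 01ZM; Görtz–Wedhorn I, (10.13) and Thm. 10.66).  **For a separated morphism of finite type
`g : X → Spec B` over a Noetherian ring `B` (e.g. a field) there are a finitely generated subring
`R ⊆ B` and a separated `R`-scheme of finite type `X' → Spec R` with `X ≅ X' ×_R Spec B` over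
`Spec B`** (`exists_isPullback_specMap_of_isNoetherianRing`, stated with a ring `R` of finite type
over `ℤ` and an injective ring map `R → B`, as in the tree's `exists_finiteTypeModel`; and
`exists_isPullback_specMap_subalgebra`, the same with `R` a finitely generated `K`-subalgebra of a
`K`-algebra `B`).  This is the case `S = Spec B = lim Spec R` (the `R ⊆ B` finitely generated) of
"schemes of finite presentation over a limit come from a finite stage" (Stacks 01ZM, EGA IV₃
8.8.2 (ii)), in the form used to spread out a complex variety, or a finite étale cover of one,
over a smooth `ℚ̄`-variety (Voisin, *Hodge loci and absolute Hodge classes* (2007), §3; Charles–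
Schnell, *Notes on absolute Hodge classes*, §11.3.5: "`X` … is defined over a field finitely
generated over `ℚ`").

## Proof

All the work is in the tree already:
1. `Limits.exists_finiteTypeModel` (Stacks 09ZP): a closed `B`-immersion `j : X ↪ Y₀ ×_{A₀} Spec B`
   for a separated `A₀`-scheme of finite type `Y₀`, `A₀ ⊆ B` a finitely generated subring;
2. `Limits.SubalgApprox.isLimitProdCone` (Görtz–Wedhorn (10.13)): `Y₀ ×_{A₀} Spec B` is the limit of
   the `Y₀ ×_{A₀} Spec A₀[t]`, `t ⊆ B` finite, a cofiltered diagram of quasi-compact quasi-separated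
   schemes with affine transition maps;
3. `Limits.exists_isPullback_toImage_of_isLocallyNoetherian` (Görtz–Wedhorn Prop. 10.75 (1)): the
   limit being locally Noetherian (of finite type over the Noetherian `B`), the closed subscheme `X`
   is the base change of its scheme-theoretic image `X' ↪ Y₀ ×_{A₀} Spec A₀[t]` for `t` large;
4. pasting with the cartesian square `Y₀ ×_{A₀} Spec B → Y₀ ×_{A₀} Spec A₀[t]` over
   `Spec B → Spec A₀[t]` (`SubalgApprox.isPullback_whiskerLeft_left`).

Everything is proved; no definitions, no named facts.

## References

* A. Grothendieck, J. Dieudonné, EGA IV₃, Publ. Math. IHÉS 28 (1966), Thm. 8.8.2 (ii). [EGAIV3]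
* The Stacks Project, Tags 01ZA, 01ZM (Limits of schemes). [StacksProject]
* U. Görtz, T. Wedhorn, *Algebraic Geometry I: Schemes*, 2nd ed. (2020), (10.13), Thm. 10.66,
  Prop. 10.75. [GortzWedhorn2020]
-/

noncomputable section

universe u

open CategoryTheory CategoryTheory.Limits AlgebraicGeometry Opposite MonoidalCategory

namespace Literature.AlgebraicGeometry.Limits

open Literature.AlgebraicGeometry.Motives (SchemeOver specOver)

set_option backward.isDefEq.respectTransparency false

/-- **Separated schemes of finite type over a Noetherian ring come from a finitely generated
subring** (EGA IV₃ 8.8.2 (ii) / Stacks 01ZM over `Spec B = lim Spec R`): for `g : X → Spec B`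
separated of finite type with `B` Noetherian there are a ring `R` of finite type over `ℤ`, an
injective ring map `ψ : R → B`, a separated `R`-scheme of finite type `p' : X' → Spec R` and a
morphism `π : X → X'` making `X` the base change `X' ×_{Spec R} Spec B` (the square
`(π, g; p', Spec ψ)` is cartesian).  Proof: finite type model (Stacks 09ZP) + descent of the closed
subscheme `X ↪ Y₀ ×_{A₀} Spec B = lim_t Y₀ ×_{A₀} Spec A₀[t]` to a finite stage (Görtz–Wedhorn
Prop. 10.75 (1)). [cite: EGAIV3, Thm. 8.8.2 (ii)] [cite: StacksProject, Tag 01ZM]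
[cite: GortzWedhorn2020, Thm. 10.66 and Prop. 10.75 (1)] -/
theorem exists_isPullback_specMap_of_isNoetherianRing {B : Type u} [CommRing B] [IsNoetherianRing B]
    {X : Scheme.{u}} (g : X ⟶ Spec (.of B)) [IsSeparated g] [LocallyOfFiniteType g]
    [QuasiCompact g] :
    ∃ (R : Type u) (_ : CommRing R) (ψ : R →+* B) (X' : Scheme.{u}) (p' : X' ⟶ Spec (.of R))
      (π : X ⟶ X'),
      Algebra.FiniteType ℤ R ∧ IsNoetherianRing R ∧ Function.Injective ψ ∧ IsSeparated p' ∧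
        LocallyOfFiniteType p' ∧ QuasiCompact p' ∧
        IsPullback π g p' (Spec.map (CommRingCat.ofHom ψ)) := by
  classical
  -- 1. finite type model: `j : X ↪ Y₀ ×_{A₀} Spec B` closed, `Y₀ → Spec A₀` separated of finite type
  obtain ⟨A₀, _, φ, Y₀, p, j, hA₀, hA₀ft, hφ, hsep, hlft, hqc, hj, hjg⟩ := exists_finiteTypeModel g
  haveI := hsep
  haveI := hlft
  haveI := hqc
  haveI := hj
  letI : Algebra A₀ B := φ.toAlgebra
  -- 2. the limit presentation `Y₀ ×_{A₀} Spec B = lim_t Y₀ ×_{A₀} Spec A₀[t]`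
  let P : SchemeOver A₀ := Over.mk p
  haveI : QuasiCompact P.hom := hqc
  haveI : IsSeparated P.hom := hsep
  haveI : LocallyOfFiniteType P.hom := hlft
  haveI : QuasiSeparated P.hom := inferInstanceAs (QuasiSeparated p)
  let D := SubalgApprox.prodDiagram A₀ B (∅ : Finset B) P
  let c := SubalgApprox.prodCone A₀ B (∅ : Finset B) P
  have hc : IsLimit c := SubalgApprox.isLimitProdCone A₀ B ∅ P
  -- the cone point is `Y₀ ×_{A₀} Spec B`, the target of `j` (definitionally)
  have hpt : c.pt = pullback p (Spec.map (CommRingCat.ofHom φ)) := rfl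
  let j' : X ⟶ c.pt := j
  haveI : IsClosedImmersion j' := hj
  -- the limit is locally Noetherian: of finite type over the Noetherian `B`
  haveI : IsLocallyNoetherian c.pt := by
    change IsLocallyNoetherian (pullback p (Spec.map (CommRingCat.ofHom φ)))
    exact LocallyOfFiniteType.isLocallyNoetherian (pullback.snd p (Spec.map (CommRingCat.ofHom φ)))
  -- 3. the closed subscheme `X` comes from a finite stage `t`
  obtain ⟨t, ht⟩ := exists_isPullback_toImage_of_isLocallyNoetherian D c hc j'
  have hsq := ht t (𝟙 t)
  -- the stage `t`: `Y₀ ×_{A₀} Spec A₀[t] → Spec A₀[t]`, and the image `X' ↪ Y₀ ×_{A₀} Spec A₀[t]`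
  let R : Subalgebra A₀ B := SubalgApprox.sub A₀ B t.unop.1
  let πt : c.pt ⟶ D.obj t := c.π.app t
  let X' : Scheme.{u} := (j' ≫ πt).image
  let ι : X' ⟶ D.obj t := (j' ≫ πt).imageι
  let q : D.obj t ⟶ Spec (.of R) := pullback.snd P.hom ((SubalgApprox.baseDiagram A₀ B ∅).obj t).hom
  haveI : IsSeparated q := inferInstanceAs (IsSeparated (pullback.snd P.hom _))
  haveI : LocallyOfFiniteType q := inferInstanceAs (LocallyOfFiniteType (pullback.snd P.hom _))
  haveI : QuasiCompact q := inferInstanceAs (QuasiCompact (pullback.snd P.hom _))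
  haveI : IsClosedImmersion ι := inferInstanceAs (IsClosedImmersion (j' ≫ πt).imageι)
  refine ⟨R, inferInstance, R.val.toRingHom, X', ι ≫ q, (j' ≫ πt).toImage, ?_, ?_, ?_, ?_, ?_, ?_, ?_⟩
  · -- `A₀[t]` is of finite type over `ℤ`
    haveI : Algebra.FiniteType A₀ R := SubalgApprox.finiteType_sub A₀ B t.unop.1
    exact Algebra.FiniteType.trans (S := A₀) hA₀ft inferInstance
  · haveI : Algebra.FiniteType A₀ R := SubalgApprox.finiteType_sub A₀ B t.unop.1
    exact Algebra.FiniteType.isNoetherianRing A₀ R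
  · exact fun x y h ↦ Subtype.ext h
  · infer_instance
  · infer_instance
  · infer_instance
  · -- 4. paste the image square with the base change square over `Spec B → Spec A₀[t]`
    have h2 : IsPullback πt (pullback.snd P.hom (specOver A₀ B).hom) q
        ((SubalgApprox.baseCone A₀ B ∅).π.app t).left :=
      SubalgApprox.isPullback_whiskerLeft_left P ((SubalgApprox.baseCone A₀ B ∅).π.app t)
    have h12 := hsq.flip.paste_vert h2
    have hg : j' ≫ pullback.snd P.hom (specOver A₀ B).hom = g := hjg
    rw [hg] at h12
    exact h12

/-- **Separated schemes of finite type over a `K`-algebra `B` (Noetherian, e.g. a field extension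
of `K`) come from a finitely generated `K`-subalgebra of `B`**: for `g : X → Spec B` separated of
finite type there are a finitely generated `K`-subalgebra `R ⊆ B`, a separated `R`-scheme of
finite type `p' : X' → Spec R` and `π : X → X'` with `(π, g; p', Spec (R ⊆ B))` cartesian (the
previous theorem, base-changed from the finitely generated subring `R₀` to the `K`-subalgebra
generated by its generators). [cite: EGAIV3, Thm. 8.8.2 (ii)] [cite: StacksProject, Tag 01ZM]
[cite: GortzWedhorn2020, Thm. 10.66] -/
theorem exists_isPullback_specMap_subalgebra {K B : Type u} [CommRing K] [CommRing B] [Algebra K B]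
    [IsNoetherianRing B] {X : Scheme.{u}} (g : X ⟶ Spec (.of B)) [IsSeparated g]
    [LocallyOfFiniteType g] [QuasiCompact g] :
    ∃ (R : Subalgebra K B) (X' : Scheme.{u}) (p' : X' ⟶ Spec (.of R)) (π : X ⟶ X'),
      R.FG ∧ IsSeparated p' ∧ LocallyOfFiniteType p' ∧ QuasiCompact p' ∧
        IsPullback π g p' (Spec.map (CommRingCat.ofHom R.val.toRingHom)) := by
  classical
  obtain ⟨R₀, _, ψ, X₀, p₀, π₀, hft, _, hψ, hsep, hlft, hqc, hsq⟩ :=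
    exists_isPullback_specMap_of_isNoetherianRing g
  haveI := hsep
  haveI := hlft
  haveI := hqc
  -- generators of `R₀` over `ℤ` and the `K`-subalgebra of `B` they generate
  obtain ⟨s, hs⟩ := Algebra.FiniteType.out (R := ℤ) (A := R₀)
  let R : Subalgebra K B := Algebra.adjoin K (ψ '' (s : Set R₀))
  have hRfg : R.FG := ⟨(s.image ψ), by simp [R]⟩
  -- `ψ` factors through `R`
  have hψR : ∀ x : R₀, ψ x ∈ R := by
    have hle : Algebra.adjoin ℤ (s : Set R₀) ≤ (R.restrictScalars ℤ).comap ψ.toIntAlgHom :=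
      Algebra.adjoin_le fun x hx ↦ Algebra.subset_adjoin ⟨x, hx, rfl⟩
    intro x
    have hx : x ∈ Algebra.adjoin ℤ (s : Set R₀) := by rw [hs]; trivial
    exact hle hx
  let ψ' : R₀ →+* R := ψ.codRestrict R hψR
  have hψ' : R.val.toRingHom.comp ψ' = ψ := RingHom.ext fun _ ↦ rfl
  -- base change `X₀` along `Spec R → Spec R₀`
  let X' : Scheme.{u} := pullback p₀ (Spec.map (CommRingCat.ofHom ψ'))
  let p' : X' ⟶ Spec (.of R) := pullback.snd _ _
  have hbc : IsPullback (pullback.fst p₀ (Spec.map (CommRingCat.ofHom ψ'))) p' p₀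
      (Spec.map (CommRingCat.ofHom ψ')) := IsPullback.of_hasPullback _ _
  -- the big square factors: `Spec ψ = Spec (R ⊆ B) ≫ Spec ψ'`
  have hfac : Spec.map (CommRingCat.ofHom ψ) =
      Spec.map (CommRingCat.ofHom R.val.toRingHom) ≫ Spec.map (CommRingCat.ofHom ψ') := by
    rw [← Spec.map_comp, ← CommRingCat.ofHom_comp, hψ']
  rw [hfac] at hsq
  -- the induced `π : X → X'` and the left square
  let π : X ⟶ X' := pullback.lift π₀ (g ≫ Spec.map (CommRingCat.ofHom R.val.toRingHom))
    (by rw [Category.assoc]; exact hsq.w)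
  have hπ₁ : π ≫ pullback.fst _ _ = π₀ := pullback.lift_fst _ _ _
  have hπ₂ : π ≫ p' = g ≫ Spec.map (CommRingCat.ofHom R.val.toRingHom) := pullback.lift_snd _ _ _
  refine ⟨R, X', p', π, hRfg, inferInstance, inferInstance, inferInstance, ?_⟩
  rw [← hπ₁] at hsq
  exact IsPullback.of_right hsq hπ₂ hbc

end Literature.AlgebraicGeometry.Limits

end
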